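import Literature.AlgebraicGeometry.Motives.SteinFactorizationCurve
import Literature.AlgebraicGeometry.HodgeTheory.AlgebraicClassesHodgeTypeHolds
import Literature.AlgebraicGeometry.HodgeTheory.SupportedClassesIrreducible
import Literature.AlgebraicGeometry.HodgeTheory.ThomGysinClosedImmersion
import Literature.AlgebraicGeometry.HodgeTheory.GysinBaseChangeOfKunneth
import Literature.AlgebraicGeometry.HodgeTheory.SurjectivePullbackInjective
import Literature.AlgebraicGeometry.HodgeTheory.TopDegreeClasses
import Literature.AlgebraicGeometry.HodgeTheory.SpreadSupportsOverCurveProofs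
import Literature.AlgebraicGeometry.HodgeTheory.PencilSpreadDescent
import HarnessLib

/-!
# Vertical support lines: classes supported on the fibres of a closed subset over a curve lie on finitely many fixed lines

Family `hodge`, layer `Literature/AlgebraicGeometry/HodgeTheory`. Theorems only (no definitions, no
named facts, D-0026).

Let `X` be smooth projective over `ℂ` of dimension `n + 1 = p + e + 1`, `T` a smooth projective curve,
`φ : X ⟶ T` a morphism, `η ∈ H²(T(ℂ); ℂ)` non-zero, and `𝒵 ⊆ X` Zariski-closed with every point of
codimension `≥ p`. **Main theorem** (`exists_verticalSupportLines`): there are a proper Zariski-closed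
`S₀ ⊊ T` and finitely supported data — a set `s ⊆ N^p H^{2p}(X(ℂ); ℂ)` of RATIONAL algebraic classes
(the normalised classes `[Z_i]` of the horizontal codimension-`p` components `Z_i` of `𝒵`) — such that
for every complex point `t ∉ S₀`, every class of `H^{2p+2}(X(ℂ); ℂ)` dying off
`(X ∖ (𝒵 ∩ φ⁻¹ t))(ℂ)` is of the form `φ^* η ∪ a` with `a ∈ span_ℂ s`.

This is the support-theoretic content of "the cohomology classes of the components of `𝒵 ∩ X_t` are
restrictions of the classes `[Z_i] ∪ [X_t]`" used in the Lefschetz-pencil step of the inductive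
approach to the Hodge conjecture (de Cataldo–Migliorini 2009 §4, Thomas 2005 §2), obtained here
WITHOUT monodromy or transport, from:

* purity on `X` — the classes of `H^{2p+2}(X(ℂ))` dying off ONE irreducible closed `D` of codimension
  `≥ p + 1` span at most a line (`exists_ker_restrictCompl_le_span_of_isIrreducible`, Fulton 1998
  Lemma 19.1.1), additivity over the irreducible pieces (`ker_restrictCompl_union_le`, Grothendieck
  1969 §1) and semipurity (`injective_restrictCompl_of_le_coheight`);
* for a horizontal component `Z = closure {ξ}` of codimension `p`: a projective resolution
  `G : W ⟶ Z ⊆ X` with its isomorphism locus (`exists_resolution_ofPoint`, Kollár Thm. 3.27), the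
  Stein factorisation `W →λ C →ρ T` of `G ≫ φ` through a smooth projective curve `C` with smooth
  connected general fibres (`Motives.exists_stein_smoothProjectiveCurve`, Hartshorne III Cor. 11.5 and
  Cor. 10.7), so that `Z ∩ φ⁻¹(t) = ⋃_{ρ(y) = t} G(λ⁻¹ y)` is a finite union of irreducible closed
  sets each carrying the NON-ZERO class `(λ⁻¹y ↪ W → X)_* 1` (Wirtinger at a point of the
  isomorphism locus, `complexGysin_one_ne_zero_of_stalkMap_surjective`);
* **the divisor line** (`exists_complexGysin_fiberι_one_eq_smul_map`): for `λ : W ⟶ C` onto a smooth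
  projective curve with smooth fibre `λ⁻¹(y)`, `(λ⁻¹y ↪ W)_* 1 ∈ ℂ · λ^* η_C` — `λ^* η_C` dies off
  `λ⁻¹(y)` (a top-degree class of `C` dies off a point, `restrictCompl_pt_eq_zero`), hence is a Gysin
  image from the smooth divisor `λ⁻¹(y)` (Thom–Gysin, `exists_complexGysin_eq_of_isClosedImmersion`)
  of a degree-`0` class, a multiple of `1` — whence, with `η_C = ρ^* η` and the projection formula,
  `(λ⁻¹y ↪ W → X)_* 1 ∈ ℂ · (φ^* η ∪ G_* 1)`.

Consumer: `HodgeTheory/PencilStepBelowMiddleOfVerdier` (the pencil step of the Hodge-conjecture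
induction below the middle dimension, granted Verdier's generic local triviality only).

## References

* [DecataldoMigliorini2009] M. A. de Cataldo, L. Migliorini, On singularities of primitive cohomology
  classes, Proc. AMS 137 (2009), §4 proof of Prop. 4.5 (arXiv:0711.1307v1 pp. 10–11).
* [Thomas2005Nodes] R. P. Thomas, Nodes and the Hodge conjecture, J. Algebraic Geom. 14 (2005), §2.
* [Fulton1998] W. Fulton, Intersection Theory, 2nd ed. (1998), §19.1 Lemma 19.1.1, Example 19.1.11.
* [GrothendieckTopology1969] A. Grothendieck, Hodge's general conjecture is false for trivial
  reasons, Topology 8 (1969), §1.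
* [VoisinHodgeII2003] C. Voisin, Hodge Theory and Complex Algebraic Geometry II (2003), §2.1.1,
  §3.3.1 and §10.2.1.
* [Hartshorne1977] R. Hartshorne, Algebraic Geometry (1977), II Ex. 3.20, III Cor. 10.7, III Cor. 11.5.
* [Kollar2007] J. Kollár, Lectures on Resolution of Singularities (2007), Thm. 3.27.
-/

noncomputable section

open CategoryTheory CategoryTheory.Limits AlgebraicGeometry Set TopologicalSpace
open Literature.AlgebraicTopology.SingularHomology
open Literature.AlgebraicGeometry.Motives

namespace Literature.AlgebraicGeometry.HodgeTheory

section HodgeTheory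

/-! ### Generalities: additivity over finitely many irreducible supports; codimension; curves -/

section Generalities

variable {n : ℕ} {X : SchemeOver ℂ}

-- Strict specialisation raises the codimension (`g ⤳ x`, `g ≠ x`, `codim g ≥ l` ⟹ `codim x ≥ l + 1`,
-- Hartshorne II Ex. 3.20): this is `add_one_le_coheight_of_specializes` (file
-- `AlgebraicClassesCupAbelianVariety`, in the import closure via `PencilSpreadDescent`).

/-- **Additivity of supports over finitely many IRREDUCIBLE closed pieces, with a prescribed bound.**
For finitely many irreducible Zariski-closed `V ⊆ X` all of whose points have codimension `≥ l`, if
every class of `H²ˡ(X(ℂ); ℂ)` dying off one `V` lies in a submodule `M`, so does every class dying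
off their union: induction on the number of pieces — either `V₀ ⊆ ⋃_{j>0} V_j` (drop it), or every
point of `V₀ ∩ ⋃_{j>0} V_j` is a strict specialisation of the generic point of `V₀`, of codimension
`≥ l + 1`, and `ker_restrictCompl_union_le` applies (`2l + 1 < 2(l + 1)`). The constrained form of
`ker_restrictCompl_sUnion_le_iSup`. [cite: GrothendieckTopology1969, §1]
[cite: Fulton1998, §19.1 Lemma 19.1.1] [cite: Hartshorne1977, II Ex. 3.20] -/
theorem ker_restrictCompl_sUnion_le_of_forall_le (hX : IsSmoothProjective n X) {l : ℕ}
    (S : Finset (Set X.left)) (hSc : ∀ V ∈ S, IsClosed V) (hSi : ∀ V ∈ S, IsIrreducible V)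
    (hSl : ∀ V ∈ S, ∀ z ∈ V, (l : ℕ∞) ≤ Order.coheight z)
    {M : Submodule ℂ (complexBetti X (2 * l))}
    (hM : ∀ V ∈ S, LinearMap.ker (complexBetti.restrictCompl X V (2 * l)).hom ≤ M) :
    LinearMap.ker (complexBetti.restrictCompl X (⋃₀ (↑S : Set (Set X.left))) (2 * l)).hom ≤ M := by
  classical
  induction S using Finset.induction_on with
  | empty =>
    intro a ha
    have ha' : complexBetti.restrictCompl X (⋃₀ (↑(∅ : Finset (Set X.left)) : Set (Set X.left)))
        (2 * l) a = 0 := ha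
    rw [Finset.coe_empty, Set.sUnion_empty] at ha'
    have hinj := injective_restrictCompl_of_le_coheight hX isClosed_empty (c := l + 1)
      (fun z hz ↦ (Set.notMem_empty z hz).elim) (i := 2 * l) (by omega)
    have h0 : a = 0 := hinj (by rw [ha', map_zero])
    rw [h0]
    exact Submodule.zero_mem _
  | insert V S hVS ih =>
    have hVc : IsClosed V := hSc V (Finset.mem_insert_self V S)
    have hVi : IsIrreducible V := hSi V (Finset.mem_insert_self V S)
    have hVl : ∀ z ∈ V, (l : ℕ∞) ≤ Order.coheight z := hSl V (Finset.mem_insert_self V S)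
    have ih' := ih (fun t ht ↦ hSc t (Finset.mem_insert_of_mem ht))
      (fun t ht ↦ hSi t (Finset.mem_insert_of_mem ht)) (fun t ht ↦ hSl t (Finset.mem_insert_of_mem ht))
      (fun t ht ↦ hM t (Finset.mem_insert_of_mem ht))
    have hU : IsClosed (⋃₀ (↑S : Set (Set X.left))) := by
      rw [Set.sUnion_eq_biUnion]
      exact S.finite_toSet.isClosed_biUnion fun t ht ↦ hSc t (Finset.mem_insert_of_mem ht)
    rw [Finset.coe_insert, Set.sUnion_insert]
    by_cases hsub : V ⊆ ⋃₀ (↑S : Set (Set X.left))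
    · rw [Set.union_eq_self_of_subset_left hsub]
      exact ih'
    · have hint : ∀ t ∈ V ∩ ⋃₀ (↑S : Set (Set X.left)), ((l + 1 : ℕ) : ℕ∞) ≤ Order.coheight t := by
        rintro x ⟨hxV, hxU⟩
        obtain ⟨t, ht, hxt⟩ := Set.mem_sUnion.1 hxU
        have hη := hVi.isGenericPoint_genericPoint hVc
        refine add_one_le_coheight_of_specializes (hη.specializes hxV) (fun heq ↦ hsub ?_)
          (hVl _ hη.mem)
        have hηt : hVi.genericPoint ∈ t := by rw [heq]; exact hxt
        exact ((hη.mem_closed_set_iff (hSc t (Finset.mem_insert_of_mem ht))).1 hηt).trans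
          (Set.subset_sUnion_of_mem ht)
      calc LinearMap.ker (complexBetti.restrictCompl X (V ∪ ⋃₀ (↑S : Set (Set X.left))) (2 * l)).hom
          ≤ LinearMap.ker (complexBetti.restrictCompl X V (2 * l)).hom ⊔
              LinearMap.ker (complexBetti.restrictCompl X (⋃₀ (↑S : Set (Set X.left))) (2 * l)).hom :=
            ker_restrictCompl_union_le hX hVc hU hint (by omega)
        _ ≤ M := sup_le (hM V (Finset.mem_insert_self V S)) ih'

/-- In an irreducible space the union of two proper closed subsets is proper. [folklore] -/
theorem union_ne_univ_of_isClosed {α : Type*} [TopologicalSpace α] [IrreducibleSpace α]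
    {A B : Set α} (hA : IsClosed A) (hAu : A ≠ Set.univ) (hB : IsClosed B) (hBu : B ≠ Set.univ) :
    A ∪ B ≠ Set.univ := by
  intro hAB
  have hirr := (IrreducibleSpace.isIrreducible_univ α).isPreirreducible
  rcases (isPreirreducible_iff_isClosed_union_isClosed.1 hirr) A B hA hB hAB.symm.subset with h | h
  · exact hAu (Set.eq_univ_of_univ_subset h)
  · exact hBu (Set.eq_univ_of_univ_subset h)

/-- In an irreducible space a finite union of proper closed subsets is proper. [folklore] -/
theorem biUnion_finset_ne_univ_of_isClosed {α ι : Type*} [TopologicalSpace α] [IrreducibleSpace α]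
    (s : Finset ι) (B : ι → Set α) (hB : ∀ i ∈ s, IsClosed (B i)) (hBu : ∀ i ∈ s, B i ≠ Set.univ) :
    (⋃ i ∈ s, B i) ≠ Set.univ := by
  classical
  induction s using Finset.induction_on with
  | empty =>
    intro h
    simp only [Finset.notMem_empty, Set.iUnion_of_empty, Set.iUnion_empty] at h
    exact (Set.empty_ne_univ h).elim
  | insert i s his ih =>
    rw [Finset.set_biUnion_insert]
    exact union_ne_univ_of_isClosed (hB i (Finset.mem_insert_self i s))
      (hBu i (Finset.mem_insert_self i s))
      ((s.finite_toSet).isClosed_biUnion fun j hj ↦ hB j (Finset.mem_insert_of_mem hj))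
      (ih (fun j hj ↦ hB j (Finset.mem_insert_of_mem hj)) (fun j hj ↦ hBu j (Finset.mem_insert_of_mem hj)))

end Generalities

section Curves

variable {T : SchemeOver ℂ}

/-- On a smooth integral complex curve every point other than the generic point is a closed point
(every specialisation of it is itself, `eq_of_specializes_of_ne_top`). [cite: Hartshorne1977, II Ex. 3.20] -/
theorem isClosed_singleton_of_ne_top [IsIntegral T.left] [SmoothOfRelativeDimension 1 T.hom]
    {c : T.left} (hc : c ≠ ⊤) : IsClosed ({c} : Set T.left) := by
  refine closure_subset_iff_isClosed.1 fun y hy ↦ ?_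
  exact Set.mem_singleton_iff.2 (eq_of_specializes_of_ne_top hc (specializes_iff_mem_closure.2 hy))

/-- A point of a smooth integral complex curve lying, under a SURJECTIVE morphism of such curves, over
a point other than the generic point is not the generic point. [folklore] -/
theorem ne_top_of_apply_ne_top {C : SchemeOver ℂ} [IsIntegral C.left] [IsIntegral T.left]
    [SmoothOfRelativeDimension 1 T.hom] (ρ : C ⟶ T) [Surjective ρ.left] {c : C.left}
    (hc : ρ.left.base c ≠ ⊤) : c ≠ ⊤ := by
  rintro rfl
  -- `ρ(⊤_C)` is a closed point `s`, `ρ⁻¹ {s}` is closed and contains the generic point, so `ρ` is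
  -- constant; but the generic point of `T` is a value of the surjective `ρ`
  have hs : IsClosed ({ρ.left.base ⊤} : Set T.left) := isClosed_singleton_of_ne_top hc
  have hpre : IsClosed (ρ.left.base ⁻¹' {ρ.left.base ⊤}) := hs.preimage ρ.left.continuous
  have hcl : closure ({(⊤ : C.left)} : Set C.left) = Set.univ := (genericPoint_spec C.left).def
  have hconst : ∀ c' : C.left, ρ.left.base c' = ρ.left.base ⊤ := fun c' ↦ by
    have h1 : closure ({(⊤ : C.left)} : Set C.left) ⊆ ρ.left.base ⁻¹' {ρ.left.base ⊤} :=
      closure_minimal (Set.singleton_subset_iff.2 rfl) hpre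
    have h2 : c' ∈ closure ({(⊤ : C.left)} : Set C.left) := by rw [hcl]; exact Set.mem_univ _
    exact h1 h2
  obtain ⟨c', hc'⟩ := ρ.left.surjective (⊤ : T.left)
  exact hc ((hconst c').symm.trans hc')

end Curves

/-! ### The divisor line: `(λ⁻¹ y ↪ W)_* 1 ∈ ℂ · λ^* η` -/

section DivisorLine

variable {d : ℕ} {W C : SchemeOver ℂ}

/-- **The Gysin class of a smooth fibre of a map to a curve lies on the line of the pulled-back point
class.** For `W` smooth projective of dimension `d + 1`, `C` a smooth projective curve, `λ : W ⟶ C`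
surjective, `y ∈ C(ℂ)` with smooth projective fibre `λ⁻¹(y)` of dimension `d`, and `η ∈ H²(C(ℂ); ℂ)`
non-zero: `(λ⁻¹ y ↪ W)_* 1 = c · λ^* η` for some `c ∈ ℂ`. Indeed `η` dies off `{y}` (a top-degree
class dies off a point, `restrictCompl_pt_eq_zero`), so `λ^* η` dies off `λ⁻¹(y) = im (λ⁻¹y ↪ W)`,
hence `λ^* η = (λ⁻¹y ↪ W)_* u` for a degree-`0` class `u = κ · 1` of the (connected) fibre
(Thom–Gysin, `exists_complexGysin_eq_of_isClosedImmersion`); and `λ^* η ≠ 0` (`λ^*` is injective for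
`λ` surjective, `complexBetti_map_injective_of_surjective`), so `κ ≠ 0`. This is "all fibres of `λ`
are cohomologous to a multiple of `λ^*[pt]`" (Fulton 1998, Example 19.1.11 / §10.1) on the carriers.
[cite: Fulton1998, §19.1 Example 19.1.11 and §10.1] [cite: VoisinHodgeII2003, §2.1.1] -/
theorem exists_complexGysin_fiberι_one_eq_smul_map (μ : OrientationFamily)
    (hW : IsSmoothProjective (d + 1) W) (hC : IsSmoothProjective 1 C) (lam : W ⟶ C)
    [Surjective lam.left] (y : ComplexPoints C) (hy : IsSmoothProjective d (fiberOver lam y))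
    {η : complexBetti C 2} (hη : η ≠ 0) :
    ∃ c : ℂ, complexGysin μ hy hW (fiberι lam y) (show 0 + 2 * (d + 1) = 2 + 2 * d by ring)
        (singularCohomology.one ℂ (ComplexPoints (fiberOver lam y))) =
      c • complexBetti.map lam 2 η := by
  haveI : IsProper C.hom := IsSmoothProjective.isProper_holds hC
  haveI : IsClosedImmersion (fiberι lam y).left := isClosedImmersion_fiberι_left lam y
  -- `lam^* η` dies off `lam⁻¹(y) = im ι_y`
  have hdies : complexBetti.restrictCompl W (lam.left.base ⁻¹' {y.pt}) 2 (complexBetti.map lam 2 η) = 0 :=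
    complexBetti.restrictCompl_map_eq_zero lam (restrictCompl_pt_eq_zero hC le_rfl y η)
  have hrange : Set.range (fiberι lam y).left.base = lam.left.base ⁻¹' {y.pt} := by
    ext w
    constructor
    · rintro ⟨z, rfl⟩
      exact apply_fiberι_base_eq_pt lam y z
    · intro hw
      exact exists_fiberι_base_eq lam y w hw
  rw [← hrange] at hdies
  obtain ⟨u, hu⟩ := exists_complexGysin_eq_of_isClosedImmersion μ hW hy (fiberι lam y)
    (show 0 + 2 * (d + 1) = 2 + 2 * d by ring) hdies
  obtain ⟨κ, rfl⟩ := exists_eq_smul_one μ hy u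
  have hne : complexBetti.map lam 2 η ≠ 0 := fun h ↦
    hη (complexBetti_map_injective_of_surjective hC hW lam 2 (by rw [h, map_zero]))
  have hκ : κ ≠ 0 := by
    rintro rfl
    rw [zero_smul, map_zero] at hu
    exact hne hu.symm
  refine ⟨κ⁻¹, ?_⟩
  rw [← hu, map_smul, smul_smul, inv_mul_cancel₀ hκ, one_smul]

end DivisorLine

/-! ### The pieces of `V ∩ φ⁻¹(t)` and their lines, for one irreducible closed `V` -/

section Component

variable {p e : ℕ} {X T : SchemeOver ℂ}

/-- **A vertical irreducible closed subset misses the fibres over the points other than its image.**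
If the generic point `ξ` of the irreducible closed `V ⊆ X` maps to a closed point of `T`, then
`φ(V)` is the closed point `φ(ξ)` and `V ∩ φ⁻¹(t) = ∅` for `t ≠ φ(ξ)`. [folklore] -/
theorem inter_preimage_eq_empty_of_vertical
    (φ : X ⟶ T) {V : Set X.left} (hV : IsClosed V) (hVi : IsIrreducible V)
    (hcl : IsClosed ({φ.left.base hVi.genericPoint} : Set T.left)) (t : ComplexPoints T)
    (ht : t.pt ≠ φ.left.base hVi.genericPoint) : V ∩ φ.left.base ⁻¹' {t.pt} = ∅ := by
  have hξ := hVi.isGenericPoint_genericPoint hV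
  refine Set.eq_empty_of_forall_notMem fun z ⟨hzV, hzt⟩ ↦ ht ?_
  have hsp : φ.left.base hVi.genericPoint ⤳ φ.left.base z := (hξ.specializes hzV).map φ.left.continuous
  have hmem : φ.left.base z ∈ ({φ.left.base hVi.genericPoint} : Set T.left) :=
    hcl.closure_eq ▸ hsp.mem_closure
  rw [Set.mem_singleton_iff] at hmem
  rw [← hmem]
  exact hzt.symm

/-- **The lines of a HORIZONTAL irreducible closed subset of codimension `p`.** Let `X` be smooth
projective of dimension `p + e + 1`, `T` a smooth projective curve, `φ : X ⟶ T`, `η ∈ H²(T(ℂ); ℂ)`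
non-zero, and `V ⊆ X` irreducible closed with generic point `ξ` of codimension `p` mapping to the
generic point of `T`. Then there are a proper closed `B ⊊ T` and a RATIONAL class
`r ∈ N^p H^{2p}(X(ℂ); ℂ)` (a multiple of `G_* 1` for a resolution `G : W ⟶ V ⊆ X`) such that for
every complex point `t ∉ B`, `V ∩ φ⁻¹(t)` is a finite union of irreducible closed pieces `D` with all
points of codimension `≥ p + 1`, and every class of `H^{2p+2}(X(ℂ); ℂ)` dying off one piece `D` is a
multiple of `φ^* η ∪ r`. Construction: resolution `W →π closure {ξ} ⊆ X` with isomorphism locus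
(`exists_resolution_ofPoint`), Stein factorisation `W →λ C →ρ T` of `G ≫ φ`
(`Motives.exists_stein_smoothProjectiveCurve`); `B` = the points of `T` over which some point of `C`
has a bad `λ`-fibre (not smooth of dimension `e`, or missing the isomorphism locus); the pieces are
`D_y = G(λ⁻¹ y)`, `ρ(y) = t`, each carrying the non-zero class `(λ⁻¹y ↪ W → X)_* 1`
(`complexGysin_one_ne_zero_of_stalkMap_surjective`) which dies off `D_y` and equals
`c · (φ^* η ∪ G_* 1)` (`exists_complexGysin_fiberι_one_eq_smul_map` with `η_C = ρ^* η`, the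
projection formula `complexGysin_cup`, `complexGysin_comp`); purity
(`exists_ker_restrictCompl_le_span_of_isIrreducible`) makes the kernel the line through it.
[cite: Fulton1998, §19.1 Lemma 19.1.1 and Example 19.1.11] [cite: Kollar2007, Thm. 3.27]
[cite: Hartshorne1977, III Cor. 11.5 and III Cor. 10.7] [cite: VoisinHodgeII2003, §3.3.1] -/
theorem exists_lines_of_horizontal (hX : IsSmoothProjective (p + e + 1) X)
    (hT : IsSmoothProjective 1 T) (φ : X ⟶ T) {V : Set X.left} (hV : IsClosed V)
    (hVi : IsIrreducible V) (hgen : ¬ IsClosed ({φ.left.base hVi.genericPoint} : Set T.left))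
    (hcoh : Order.coheight hVi.genericPoint = p) (hcV : ∀ v ∈ V, (p : ℕ∞) ≤ Order.coheight v)
    {η : complexBetti T 2} (hη : η ≠ 0) :
    ∃ B : Set T.left, IsClosed B ∧ B ≠ Set.univ ∧
      ∃ r : complexBetti X (2 * p), r ∈ algebraicClasses X p ∧ IsRationalClass r ∧
        ∀ t : ComplexPoints T, t.pt ∉ B →
          ∃ F : Finset (Set X.left), V ∩ φ.left.base ⁻¹' {t.pt} = ⋃₀ (↑F : Set (Set X.left)) ∧
            ∀ D ∈ F, IsClosed D ∧ IsIrreducible D ∧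
              (∀ z ∈ D, ((p + 1 : ℕ) : ℕ∞) ≤ Order.coheight z) ∧
              LinearMap.ker (complexBetti.restrictCompl X D (2 * (p + 1))).hom ≤
                Submodule.span ℂ {cupProduct (show 2 + 2 * p = 2 * (p + 1) by ring)
                  (complexBetti.map φ 2 η) r} := by
  classical
  -- instances; the generic point of `V` maps to the generic point of `T`
  haveI : IsIntegral T.left := IsSmoothProjective.isIntegral_holds hT
  haveI : SmoothOfRelativeDimension 1 T.hom := hT.smoothOfRelativeDimension
  haveI : IsProper T.hom := IsSmoothProjective.isProper_holds hT
  haveI : IrreducibleSpace T.left := hT.irreducibleSpace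
  haveI : IsProper X.hom := IsSmoothProjective.isProper_holds hX
  haveI : IsIntegral X.left := IsSmoothProjective.isIntegral_holds hX
  haveI : IsProper φ.left := by
    haveI : IsProper (φ.left ≫ T.hom) := by rw [Over.w φ]; infer_instance
    exact IsProper.of_comp φ.left T.hom
  let μ : OrientationFamily := fun _ _ hZ ↦ (ComplexPoints.isOrientableOver ℂ hZ).some
  have hμ : μ.HasPoincareDuality := OrientationFamily.hasPoincareDuality μ
  have hS := gysinMap_restrictCompl_eq_zero_of_field.{0, 0} ℂ
  -- the generic point `ξ` of `V`: height `e + 1`, codimension `p`, over the generic point of `T`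
  set ξ := hVi.genericPoint with hξdef
  have hξ : IsGenericPoint ξ V := hVi.isGenericPoint_genericPoint hV
  have hgen' : φ.left.base ξ = ⊤ := by
    by_contra h
    exact hgen (isClosed_singleton_of_ne_top h)
  obtain ⟨a, c, hξa, hξc, hac⟩ := exists_height_eq_coheight_eq hX ξ
  obtain rfl : p = c := by
    rw [hξc] at hcoh
    exact_mod_cast hcoh.symm
  obtain rfl : a = e + 1 := by omega
  have htpt : ∀ t : ComplexPoints T, t.pt ≠ φ.left.base ξ := fun t ↦ by
    rw [hgen']
    exact pt_ne_top_of_smoothCurve t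
  -- (a) a resolution `π : W ⟶ closure {ξ}`, `G = π ≫ ι : W ⟶ X`, `im G = V`
  set X₀ := ClosedSubvariety.ofPoint X.left ξ with hX₀
  obtain ⟨d', W, π, hW, hπ, hdim⟩ :=
    exists_resolution_ofPoint Resolution.Hironaka1964_projective_holds hX ξ
  obtain rfl : d' = e + 1 := by
    rw [hξa] at hdim
    exact_mod_cast hdim.symm
  haveI : IsIntegral X₀.toSchemeOver.left := inferInstanceAs (IsIntegral X₀.carrier)
  haveI : IsProper W.hom := IsSmoothProjective.isProper_holds hW
  haveI : IsIntegral W.left := IsSmoothProjective.isIntegral_holds hW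
  haveI : LocallyOfFiniteType W.hom := locallyOfFiniteType_of_isSmoothProjective hW
  haveI : JacobsonSpace W.left := LocallyOfFiniteType.jacobsonSpace W.hom
  haveI : IsProper π.left := by
    haveI : IsProper (π.left ≫ X₀.toSchemeOver.hom) := by rw [Over.w π]; infer_instance
    haveI : IsSeparated X₀.toSchemeOver.hom := by
      change IsSeparated (X₀.ι ≫ X.hom)
      infer_instance
    exact IsProper.of_comp π.left X₀.toSchemeOver.hom
  let G : W ⟶ X := π ≫ X₀.ιOver
  have hGleft : G.left = π.left ≫ X₀.ι := rfl
  have hπsurj : Function.Surjective π.left.base := surjective_base_of_isBirational π.left hπ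
  have hrangeG : Set.range G.left.base = V := by
    rw [hGleft, Scheme.Hom.comp_base, TopCat.coe_comp, Set.range_comp, hπsurj.range_eq,
      Set.image_univ]
    exact (ClosedSubvariety.range_ofPoint_ι ξ).trans hξ.def
  -- (b) `ψ = G ≫ φ : W ⟶ T` is surjective (proper, and the generic point of `T` is a value)
  let ψ : W ⟶ T := G ≫ φ
  have hψleft : ∀ w, ψ.left.base w = φ.left.base (G.left.base w) := fun w ↦ rfl
  haveI : IsProper ψ.left := by
    haveI : IsProper (ψ.left ≫ T.hom) := by rw [Over.w ψ]; infer_instance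
    exact IsProper.of_comp ψ.left T.hom
  haveI hψs : Surjective ψ.left := by
    refine ⟨fun s ↦ ?_⟩
    have hcl : IsClosed (Set.range ψ.left.base) := ψ.left.isClosedMap.isClosed_range
    obtain ⟨w, hw⟩ : ξ ∈ Set.range G.left.base := hrangeG ▸ hξ.mem
    have htop : (⊤ : T.left) ∈ Set.range ψ.left.base := ⟨w, by rw [hψleft, hw, hgen']⟩
    have huniv : Set.range ψ.left.base = Set.univ :=
      Set.eq_univ_of_univ_subset (((genericPoint_spec T.left).mem_closed_set_iff hcl).1 htop)
    have hs : s ∈ Set.range ψ.left.base := huniv ▸ Set.mem_univ s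
    exact hs
  -- (c) the Stein factorisation of `ψ` through a smooth projective curve `C`
  obtain ⟨C, lam, ρ, hfac, hC, hρf, hρs, hls, -, -, hopen, hGt, V₀, hV₀, hgood⟩ :=
    exists_stein_smoothProjectiveCurve hW hT ψ
  haveI := hρf
  haveI := hρs
  haveI := hls
  haveI : IsIntegral C.left := IsSmoothProjective.isIntegral_holds hC
  haveI : SmoothOfRelativeDimension 1 C.hom := hC.smoothOfRelativeDimension
  haveI : IsProper C.hom := IsSmoothProjective.isProper_holds hC
  haveI : LocallyOfFiniteType C.hom := locallyOfFiniteType_of_isSmoothProjective hC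
  have hfacw : ∀ w, ρ.left.base (lam.left.base w) = φ.left.base (G.left.base w) := fun w ↦ by
    rw [← hψleft, ← hfac]
    rfl
  -- (d) the isomorphism locus of `π`, the two bad sets
  obtain ⟨U, -, hU'd, hiso⟩ := hπ
  haveI := hiso
  let O : C.left.Opens :=
    ⟨lam.left.base '' (π.left ⁻¹ᵁ U : Set W.left), hopen _ (π.left ⁻¹ᵁ U).isOpen⟩
  have hOne : ((O : C.left.Opens) : Set C.left).Nonempty := hU'd.nonempty.image _
  obtain ⟨B₁, hB₁c, hB₁u, hB₁⟩ := hGt O hOne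
  obtain ⟨B₂, hB₂c, hB₂u, hB₂⟩ := hGt V₀ hV₀
  -- (e) the class `r`: `G_* 1 = u • r`, `r` rational and algebraic
  have hab₁ : 0 + 2 * (p + e + 1) = 2 * p + 2 * (e + 1) := by ring
  obtain ⟨u, hu0, hu⟩ := exists_smul_isRationalClass_complexGysin μ hW hX G hab₁
  obtain ⟨r, hrQ, hr⟩ := hu _ (isRationalClass_one _)
  have hG1alg : complexGysin μ hW hX G hab₁ (singularCohomology.one ℂ (ComplexPoints W)) ∈
      algebraicClasses X p :=
    complexGysin_mem_algebraicClasses hS μ hμ hW hX G (q := 0) (p := p) (by ring) _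
      (by rw [algebraicClasses_zero]; exact Submodule.mem_top)
  have hralg : r ∈ algebraicClasses X p := by
    have h1 : r = u⁻¹ • complexGysin μ hW hX G hab₁ (singularCohomology.one ℂ (ComplexPoints W)) := by
      rw [hr, smul_smul, inv_mul_cancel₀ hu0, one_smul]
    rw [h1]
    exact Submodule.smul_mem _ _ hG1alg
  refine ⟨B₁ ∪ B₂, hB₁c.union hB₂c, union_ne_univ_of_isClosed hB₁c hB₁u hB₂c hB₂u, r, hralg, hrQ,
    fun t ht ↦ ?_⟩
  -- (f) a complex point `t ∉ B₁ ∪ B₂`: the finitely many complex points of `C` over it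
  have hfin : {y : ComplexPoints C | ρ.left.base y.pt = t.pt}.Finite := by
    have h1 : (ρ.left.base ⁻¹' {t.pt}).Finite := ρ.left.finite_preimage_singleton t.pt
    have hinj : Set.InjOn (fun y : ComplexPoints C ↦ y.pt)
        ((fun y : ComplexPoints C ↦ y.pt) ⁻¹' (ρ.left.base ⁻¹' {t.pt})) := fun y _ y' _ h ↦
      (ComplexPoints.equivClosedPoints C).injective (Subtype.ext h)
    exact h1.preimage hinj
  -- the pieces `D_y = im (λ⁻¹ y ↪ W → X)`
  let Dset : ComplexPoints C → Set X.left := fun y ↦ Set.range (fiberι lam y ≫ G).left.base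
  have hDleft : ∀ (y : ComplexPoints C) (w' : (fiberOver lam y).left),
      (fiberι lam y ≫ G).left.base w' = G.left.base ((fiberι lam y).left.base w') := fun y w' ↦ rfl
  refine ⟨hfin.toFinset.image Dset, ?_, fun D hD ↦ ?_⟩
  · -- `V ∩ φ⁻¹(t) = ⋃_{ρ y = t} D_y`
    ext z
    simp only [Finset.coe_image, Set.sUnion_image, Finset.mem_coe, Set.Finite.mem_toFinset,
      Set.mem_setOf_eq, Set.mem_iUnion, Set.mem_inter_iff, Set.mem_preimage, Set.mem_singleton_iff,
      exists_prop]
    constructor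
    · rintro ⟨hzV, hzt⟩
      obtain ⟨w, rfl⟩ : z ∈ Set.range G.left.base := hrangeG ▸ hzV
      have hct : ρ.left.base (lam.left.base w) = t.pt := by rw [hfacw, hzt]
      have hcne : lam.left.base w ≠ ⊤ :=
        ne_top_of_apply_ne_top ρ (by rw [hct]; exact pt_ne_top_of_smoothCurve t)
      have hccl : IsClosed ({lam.left.base w} : Set C.left) := isClosed_singleton_of_ne_top hcne
      set y : ComplexPoints C :=
        (ComplexPoints.equivClosedPoints C).symm ⟨lam.left.base w, hccl⟩ with hydef
      have hypt : y.pt = lam.left.base w := by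
        have h := ComplexPoints.coe_equivClosedPoints_apply C y
        rw [hydef, Equiv.apply_symm_apply] at h
        exact h.symm
      refine ⟨y, by rw [hypt, hct], ?_⟩
      obtain ⟨w', hw'⟩ := exists_fiberι_base_eq lam y w hypt.symm
      exact ⟨w', by rw [hDleft, hw']⟩
    · rintro ⟨y, hyt, w', rfl⟩
      refine ⟨hrangeG ▸ ⟨(fiberι lam y).left.base w', (hDleft y w').symm⟩, ?_⟩
      rw [hDleft, ← hfacw, apply_fiberι_base_eq_pt lam y w', hyt]
  -- a piece `D = D_y`, `ρ(y) = t`: `y` is a good point of `C`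
  obtain ⟨y, hy, rfl⟩ := Finset.mem_image.1 hD
  have hyt : ρ.left.base y.pt = t.pt := (Set.Finite.mem_toFinset hfin).1 hy
  have hyB : ρ.left.base y.pt ∉ B₁ ∪ B₂ := by rw [hyt]; exact ht
  have hyV₀ : y.pt ∈ V₀ := hB₂ _ fun h ↦ hyB (Or.inr h)
  have hyO : y.pt ∈ ((O : C.left.Opens) : Set C.left) := hB₁ _ fun h ↦ hyB (Or.inl h)
  have hFy : IsSmoothProjective e (fiberOver lam y) := hgood y hyV₀
  haveI : IsClosedImmersion (fiberι lam y).left := isClosedImmersion_fiberι_left lam y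
  haveI : IsProper (fiberOver lam y).hom := IsSmoothProjective.isProper_holds hFy
  haveI : LocallyOfFiniteType (fiberOver lam y).hom := locallyOfFiniteType_of_isSmoothProjective hFy
  haveI : IrreducibleSpace (fiberOver lam y).left := hFy.irreducibleSpace
  haveI : IsProper (fiberι lam y ≫ G).left := by
    haveI : IsProper ((fiberι lam y ≫ G).left ≫ X.hom) := by rw [Over.w]; infer_instance
    exact IsProper.of_comp (fiberι lam y ≫ G).left X.hom
  -- `D_y` is closed, irreducible, inside `V ∩ φ⁻¹(t)`, of codimension `≥ p + 1`
  have hDc : IsClosed (Dset y) := (fiberι lam y ≫ G).left.isClosedMap.isClosed_range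
  have hDi : IsIrreducible (Dset y) := by
    have h := (IrreducibleSpace.isIrreducible_univ (fiberOver lam y).left).image
      (fiberι lam y ≫ G).left.base (fiberι lam y ≫ G).left.continuous.continuousOn
    rwa [Set.image_univ] at h
  have hDcoh : ∀ z ∈ Dset y, ((p + 1 : ℕ) : ℕ∞) ≤ Order.coheight z := by
    rintro _ ⟨w', rfl⟩
    have hzV : (fiberι lam y ≫ G).left.base w' ∈ V :=
      hrangeG ▸ ⟨(fiberι lam y).left.base w', (hDleft y w').symm⟩
    have hzt : φ.left.base ((fiberι lam y ≫ G).left.base w') = t.pt := by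
      rw [hDleft, ← hfacw, apply_fiberι_base_eq_pt lam y w', hyt]
    refine add_one_le_coheight_of_specializes (hξ.specializes hzV) (fun heq ↦ ?_) (hcV ξ hξ.mem)
    exact htpt t (by rw [← hzt, ← heq])
  refine ⟨hDc, hDi, hDcoh, ?_⟩
  -- the class `v = (λ⁻¹y ↪ W → X)_* 1`
  have habv : 0 + 2 * (p + e + 1) = 2 * (p + 1) + 2 * e := by ring
  set v : complexBetti X (2 * (p + 1)) := complexGysin μ hFy hX (fiberι lam y ≫ G) habv
    (singularCohomology.one ℂ (ComplexPoints (fiberOver lam y))) with hvdef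
  -- `v ≠ 0`: a closed point of `λ⁻¹(y)` over the isomorphism locus of `π`
  have hv0 : v ≠ 0 := by
    obtain ⟨w₀, hw₀U, hw₀y⟩ := hyO
    have hM : ((π.left ⁻¹ᵁ U : Set W.left) ∩ lam.left.base ⁻¹' {y.pt}).Nonempty := ⟨w₀, hw₀U, hw₀y⟩
    have hMlc : IsLocallyClosed ((π.left ⁻¹ᵁ U : Set W.left) ∩ lam.left.base ⁻¹' {y.pt}) :=
      (π.left ⁻¹ᵁ U).isOpen.isLocallyClosed.inter (y.isClosed_pt.preimage lam.left.continuous).isLocallyClosed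
    obtain ⟨w₁, ⟨hw₁U, hw₁y⟩, hw₁cl⟩ := nonempty_inter_closedPoints hM hMlc
    obtain ⟨f₁, hf₁⟩ := exists_fiberι_base_eq lam y w₁ hw₁y
    have hf₁cl : IsClosed ({f₁} : Set (fiberOver lam y).left) := by
      have h1 : ({f₁} : Set (fiberOver lam y).left) = (fiberι lam y).left.base ⁻¹' {w₁} := by
        ext f
        simp only [Set.mem_singleton_iff, Set.mem_preimage]
        constructor
        · rintro rfl
          exact hf₁
        · intro hf
          exact (fiberι lam y).left.isClosedEmbedding.injective (hf.trans hf₁.symm)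
      rw [h1]
      exact (mem_closedPoints_iff.mp hw₁cl).preimage (fiberι lam y).left.continuous
    set P : ComplexPoints (fiberOver lam y) :=
      (ComplexPoints.equivClosedPoints (fiberOver lam y)).symm ⟨f₁, mem_closedPoints_iff.mpr hf₁cl⟩
      with hPdef
    have hPpt : P.pt = f₁ := by
      have h := ComplexPoints.coe_equivClosedPoints_apply (fiberOver lam y) P
      rw [hPdef, Equiv.apply_symm_apply] at h
      exact h.symm
    have hsurj : Function.Surjective ((fiberι lam y ≫ G).left.stalkMap P.pt) := by
      rw [hPpt, Over.comp_left, Scheme.Hom.stalkMap_comp]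
      have h1 : Function.Surjective ((fiberι lam y).left.stalkMap f₁) :=
        (fiberι lam y).left.stalkMap_surjective f₁
      have h2 : Function.Surjective (G.left.stalkMap ((fiberι lam y).left.base f₁)) := by
        rw [hf₁, hGleft]
        exact @stalkMap_comp_surjective_of_isIso_morphismRestrict _ _ _ π.left X₀.ι
          X₀.isClosedImmersion U hiso w₁ hw₁U
      intro s₁
      obtain ⟨s₂, rfl⟩ := h1 s₁
      obtain ⟨s₃, rfl⟩ := h2 s₂
      exact ⟨s₃, rfl⟩
    exact complexGysin_one_ne_zero_of_stalkMap_surjective μ hX hFy (fiberι lam y ≫ G) P hsurj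
      (e := p + 1) (by omega)
  -- `v` dies off `D_y`
  have hvker : complexBetti.restrictCompl X (Dset y) (2 * (p + 1)) v = 0 := by
    refine complexGysin_restrictCompl_eq_zero hS μ hμ hFy hX (fiberι lam y ≫ G) habv hDc _ ?_
    have hpre : (fiberι lam y ≫ G).left.base ⁻¹' Dset y = Set.univ :=
      Set.eq_univ_of_forall fun w' ↦ ⟨w', rfl⟩
    haveI : IsEmpty (complexPointsCompl (fiberOver lam y) ((fiberι lam y ≫ G).left.base ⁻¹' Dset y)) :=
      ⟨fun Q ↦ Q.2 (Set.eq_univ_iff_forall.1 hpre _)⟩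
    haveI := ModuleCat.subsingleton_of_isZero (isZero_singularCohomology_of_isEmpty ℂ ℂ
      (E := complexPointsCompl (fiberOver lam y) ((fiberι lam y ≫ G).left.base ⁻¹' Dset y)) 0)
    exact Subsingleton.elim _ _
  -- `v = (c u) • (φ^* η ∪ r)`: divisor line on `W` with `η_C = ρ^* η`, projection formula for `G`
  have hρη : complexBetti.map ρ 2 η ≠ 0 := fun h ↦
    hη (complexBetti_map_injective_of_surjective hT hC ρ 2 (by rw [h, map_zero]))
  obtain ⟨c₁, hc₁⟩ := exists_complexGysin_fiberι_one_eq_smul_map μ hW hC lam y hFy hρη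
  have hvform : v = (c₁ * u) • cupProduct (show 2 + 2 * p = 2 * (p + 1) by ring)
      (complexBetti.map φ 2 η) r := by
    have hcomp := complexGysin_comp hμ hFy hW hX (fiberι lam y) G
      (show 0 + 2 * (e + 1) = 2 + 2 * e by ring) (show 2 + 2 * (p + e + 1) = 2 * (p + 1) + 2 * (e + 1) by ring)
    have h1 : v = complexGysin μ hW hX G (show 2 + 2 * (p + e + 1) = 2 * (p + 1) + 2 * (e + 1) by ring)
        (complexGysin μ hFy hW (fiberι lam y) (show 0 + 2 * (e + 1) = 2 + 2 * e by ring)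
          (singularCohomology.one ℂ (ComplexPoints (fiberOver lam y)))) := by
      rw [hvdef, hcomp, LinearMap.comp_apply]
    have h2 : complexBetti.map lam 2 (complexBetti.map ρ 2 η) =
        complexBetti.map G 2 (complexBetti.map φ 2 η) := by
      rw [← CategoryTheory.comp_apply, ← complexBetti.map_comp, hfac, complexBetti.map_comp,
        CategoryTheory.comp_apply]
    have h3 := complexGysin_cup hμ hW hX G (Nat.add_zero 2)
      (show 2 + 2 * (p + e + 1) = 2 * (p + 1) + 2 * (e + 1) by ring) hab₁
      (show 2 + 2 * p = 2 * (p + 1) by ring) (complexBetti.map φ 2 η)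
      (singularCohomology.one ℂ (ComplexPoints W))
    rw [cupProduct_one] at h3
    rw [h1, hc₁, map_smul, h2, h3, hr, map_smul, smul_smul]
  -- purity: the kernel is the line through `v`
  obtain ⟨τ, hτ⟩ := exists_ker_restrictCompl_le_span_of_isIrreducible hX hDc hDi (c := p + 1)
    (by omega) hDcoh
  obtain ⟨α, hα⟩ := Submodule.mem_span_singleton.1 (hτ (LinearMap.mem_ker.2 hvker))
  have hα0 : α ≠ 0 := by
    rintro rfl
    rw [zero_smul] at hα
    exact hv0 hα.symm
  intro x hx
  obtain ⟨β, hβ⟩ := Submodule.mem_span_singleton.1 (hτ hx)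
  rw [Submodule.mem_span_singleton]
  refine ⟨β / α * (c₁ * u), ?_⟩
  rw [← hβ, ← smul_smul, ← hvform, ← hα, smul_smul, div_mul_cancel₀ β hα0]

/-- **The lines of ANY irreducible closed subset of codimension `≥ p`** (uniform form of
`exists_lines_of_horizontal`): for `V ⊆ X` irreducible closed with every point of codimension `≥ p`
there are a proper closed `B ⊊ T` and a rational class `r ∈ N^p H^{2p}(X(ℂ); ℂ)` such that for every
complex `t ∉ B`, `V ∩ φ⁻¹(t)` is a finite union of irreducible closed pieces of codimension
`≥ p + 1`, each of whose supported classes in `H^{2p+2}(X(ℂ); ℂ)` are multiples of `φ^* η ∪ r`.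
Three cases: `V` vertical (`B = {φ(ξ)}`, no pieces, `inter_preimage_eq_empty_of_vertical`); `V`
horizontal of codimension `≥ p + 1` (`B = ∅`, `r = 0`, the pieces of `V ∩ φ⁻¹(t)` have codimension
`≥ p + 2` and carry no class of degree `2p + 2`, semipurity); `V` horizontal of codimension `p`
(`exists_lines_of_horizontal`). [cite: Fulton1998, §19.1 Lemma 19.1.1]
[cite: GrothendieckTopology1969, §1] [cite: VoisinHodgeII2003, §3.3.1] -/
theorem exists_lines_of_isIrreducible (hX : IsSmoothProjective (p + e + 1) X)
    (hT : IsSmoothProjective 1 T) (φ : X ⟶ T) {V : Set X.left} (hV : IsClosed V)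
    (hVi : IsIrreducible V) (hcV : ∀ v ∈ V, (p : ℕ∞) ≤ Order.coheight v)
    {η : complexBetti T 2} (hη : η ≠ 0) :
    ∃ B : Set T.left, IsClosed B ∧ B ≠ Set.univ ∧
      ∃ r : complexBetti X (2 * p), r ∈ algebraicClasses X p ∧ IsRationalClass r ∧
        ∀ t : ComplexPoints T, t.pt ∉ B →
          ∃ F : Finset (Set X.left), V ∩ φ.left.base ⁻¹' {t.pt} = ⋃₀ (↑F : Set (Set X.left)) ∧
            ∀ D ∈ F, IsClosed D ∧ IsIrreducible D ∧
              (∀ z ∈ D, ((p + 1 : ℕ) : ℕ∞) ≤ Order.coheight z) ∧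
              LinearMap.ker (complexBetti.restrictCompl X D (2 * (p + 1))).hom ≤
                Submodule.span ℂ {cupProduct (show 2 + 2 * p = 2 * (p + 1) by ring)
                  (complexBetti.map φ 2 η) r} := by
  classical
  haveI : IsIntegral T.left := IsSmoothProjective.isIntegral_holds hT
  haveI : SmoothOfRelativeDimension 1 T.hom := hT.smoothOfRelativeDimension
  haveI : IrreducibleSpace T.left := hT.irreducibleSpace
  haveI : IsProper X.hom := IsSmoothProjective.isProper_holds hX
  haveI := Motives.IsSmoothProjective.isLocallyNoetherian_holds hX
  haveI := Motives.IsSmoothProjective.compactSpace_holds hX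
  haveI : IsNoetherian X.left := {}
  haveI : NoetherianSpace X.left := inferInstance
  have h0Q : IsRationalClass (0 : complexBetti X (2 * p)) := IsRationalClass.zero
  set ξ := hVi.genericPoint with hξdef
  have hξ : IsGenericPoint ξ V := hVi.isGenericPoint_genericPoint hV
  by_cases hgen : IsClosed ({φ.left.base ξ} : Set T.left)
  swap
  · -- horizontal: `φ(ξ)` is the generic point of `T`
    have hgen' : φ.left.base ξ = ⊤ := by
      by_contra h
      exact hgen (isClosed_singleton_of_ne_top h)
    obtain ⟨a, c, -, hξc, -⟩ := exists_height_eq_coheight_eq hX ξ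
    have hpc : p ≤ c := by
      have h := hcV ξ hξ.mem
      rw [hξc] at h
      exact_mod_cast h
    rcases hpc.eq_or_lt with rfl | hlt
    · exact exists_lines_of_horizontal hX hT φ hV hVi hgen hξc hcV hη
    · -- codimension `≥ p + 1`: no classes of degree `2p + 2` on the pieces of `V ∩ φ⁻¹(t)`
      refine ⟨∅, isClosed_empty, Set.empty_ne_univ, 0, Submodule.zero_mem _, h0Q, fun t _ ↦ ?_⟩
      have hZc : IsClosed (V ∩ φ.left.base ⁻¹' {t.pt}) := hV.inter (t.isClosed_pt.preimage φ.left.continuous)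
      obtain ⟨S, hSf, hSc, hSi, hZS⟩ := NoetherianSpace.exists_finite_set_isClosed_irreducible hZc
      refine ⟨hSf.toFinset, by rw [hSf.coe_toFinset]; exact hZS, fun D hD ↦ ?_⟩
      rw [Set.Finite.mem_toFinset] at hD
      have hDsub : D ⊆ V ∩ φ.left.base ⁻¹' {t.pt} := hZS ▸ Set.subset_sUnion_of_mem hD
      have hDcoh : ∀ z ∈ D, ((p + 1 + 1 : ℕ) : ℕ∞) ≤ Order.coheight z := fun z hz ↦ by
        obtain ⟨hzV, hzt⟩ := hDsub hz
        have hξz : ξ ≠ z := fun heq ↦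
          pt_ne_top_of_smoothCurve t (by rw [← hgen', heq]; exact hzt.symm)
        have hc1 : ((p + 1 : ℕ) : ℕ∞) ≤ Order.coheight ξ := by
          rw [hξc]
          exact_mod_cast hlt
        exact add_one_le_coheight_of_specializes (hξ.specializes hzV) hξz hc1
      refine ⟨hSc D hD, hSi D hD, fun z hz ↦ (le_trans (by exact_mod_cast Nat.le_succ _) (hDcoh z hz)),
        fun x hx ↦ ?_⟩
      have hinj := injective_restrictCompl_of_le_coheight hX (hSc D hD) (c := p + 1 + 1) hDcoh
        (i := 2 * (p + 1)) (by omega)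
      have hx0 : x = 0 := hinj (by rw [LinearMap.mem_ker.1 hx, map_zero])
      rw [hx0]
      exact Submodule.zero_mem _
  · -- vertical: `φ(ξ)` is a closed point
    refine ⟨{φ.left.base ξ}, hgen, fun h ↦ ?_, 0,
      Submodule.zero_mem _, h0Q, fun t ht ↦ ⟨∅, ?_, fun D hD ↦ (Finset.notMem_empty D hD).elim⟩⟩
    · have hmem : (⊤ : T.left) ∈ ({φ.left.base ξ} : Set T.left) := h ▸ Set.mem_univ _
      rw [Set.mem_singleton_iff] at hmem
      rw [← hmem] at hgen
      exact not_isClosed_singleton_top_of_smoothCurve hgen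
    · rw [Finset.coe_empty, Set.sUnion_empty]
      exact inter_preimage_eq_empty_of_vertical φ hV hVi hgen t ht

end Component

/-! ### The main theorem -/

section Main

variable {p e : ℕ} {X T : SchemeOver ℂ}

/-- **Vertical support lines.** Let `X` be smooth projective over `ℂ` of dimension `p + e + 1`, `T` a
smooth projective curve, `φ : X ⟶ T`, `η ∈ H²(T(ℂ); ℂ)` non-zero, and `𝒵 ⊆ X` Zariski-closed with
every point of codimension `≥ p`. There are a proper Zariski-closed `S₀ ⊊ T` and a set `s` of
RATIONAL classes in `N^p H^{2p}(X(ℂ); ℂ)` such that for every complex point `t ∉ S₀`, every class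
`x ∈ H^{2p+2}(X(ℂ); ℂ)` vanishing on `(X ∖ (𝒵 ∩ φ⁻¹ t))(ℂ)` is `φ^* η ∪ a` for some `a ∈ span_ℂ s`.
Proof: decompose `𝒵` into finitely many irreducible closed `V` (`X` is Noetherian); `S₀` is the union
of the bad sets of `exists_lines_of_isIrreducible`, `s` the set of its classes `r_V`; for `t ∉ S₀`,
`𝒵 ∩ φ⁻¹(t)` is a finite union of irreducible closed pieces of codimension `≥ p + 1` whose supported
classes lie in `φ^* η ∪ span s`, and additivity over irreducible pieces
(`ker_restrictCompl_sUnion_le_of_forall_le`) concludes. The rigidity "the classes of the vertical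
cycles `𝒵 ∩ X_t` come from the fixed classes `[Z_i] ∪ [X_t]`" of the pencil method, support form.
[cite: DecataldoMigliorini2009, §4 proof of Prop. 4.5] [cite: Thomas2005Nodes, §2 proof of Prop. 2]
[cite: Fulton1998, §19.1 Lemma 19.1.1 and Example 19.1.11] [cite: GrothendieckTopology1969, §1] -/
theorem exists_verticalSupportLines (hX : IsSmoothProjective (p + e + 1) X)
    (hT : IsSmoothProjective 1 T) (φ : X ⟶ T) {𝒵 : Set X.left} (h𝒵 : IsClosed 𝒵)
    (hc𝒵 : ∀ z ∈ 𝒵, (p : ℕ∞) ≤ Order.coheight z) {η : complexBetti T 2} (hη : η ≠ 0) :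
    ∃ S₀ : Set T.left, IsClosed S₀ ∧ S₀ ≠ Set.univ ∧
      ∃ s : Set (complexBetti X (2 * p)), (∀ a ∈ s, a ∈ algebraicClasses X p ∧ IsRationalClass a) ∧
        ∀ t : ComplexPoints T, t.pt ∉ S₀ → ∀ x : complexBetti X (2 * (p + 1)),
          complexBetti.restrictCompl X (𝒵 ∩ φ.left.base ⁻¹' {t.pt}) (2 * (p + 1)) x = 0 →
            ∃ a ∈ Submodule.span ℂ s,
              x = cupProduct (show 2 + 2 * p = 2 * (p + 1) by ring) (complexBetti.map φ 2 η) a := by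
  classical
  haveI : IrreducibleSpace T.left := hT.irreducibleSpace
  haveI := Motives.IsSmoothProjective.isLocallyNoetherian_holds hX
  haveI := Motives.IsSmoothProjective.compactSpace_holds hX
  haveI : IsNoetherian X.left := {}
  haveI : NoetherianSpace X.left := inferInstance
  -- the irreducible pieces of `𝒵` and their data
  obtain ⟨S, hSf, hSc, hSi, hZS⟩ := NoetherianSpace.exists_finite_set_isClosed_irreducible h𝒵
  have hSl : ∀ V ∈ S, ∀ v ∈ V, (p : ℕ∞) ≤ Order.coheight v := fun V hV v hv ↦
    hc𝒵 v (hZS ▸ Set.mem_sUnion_of_mem hv hV)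
  choose B hBc hBu r hr using fun V : S ↦
    exists_lines_of_isIrreducible hX hT φ (hSc V V.2) (hSi V V.2) (hSl V V.2) hη
  haveI : Fintype S := hSf.fintype
  refine ⟨⋃ V ∈ (Finset.univ : Finset S), B V, ?_, ?_, Set.range r, ?_, fun t ht x hx ↦ ?_⟩
  · exact (Finset.univ : Finset S).finite_toSet.isClosed_biUnion fun V _ ↦ hBc V
  · exact biUnion_finset_ne_univ_of_isClosed _ B (fun V _ ↦ hBc V) (fun V _ ↦ hBu V)
  · rintro _ ⟨V, rfl⟩
    exact ⟨(hr V).1, (hr V).2.1⟩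
  -- `t ∉ S₀`: the pieces of `𝒵 ∩ φ⁻¹(t)`
  have htV : ∀ V : S, t.pt ∉ B V := fun V h ↦ ht (Set.mem_biUnion (Finset.mem_univ V) h)
  choose F hF hFD using fun V : S ↦ (hr V).2.2 t (htV V)
  -- the target submodule
  set L : complexBetti X (2 * p) →ₗ[ℂ] complexBetti X (2 * (p + 1)) :=
    cupProduct (show 2 + 2 * p = 2 * (p + 1) by ring) (complexBetti.map φ 2 η) with hLdef
  set M : Submodule ℂ (complexBetti X (2 * (p + 1))) := (Submodule.span ℂ (Set.range r)).map L
    with hMdef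
  suffices hxM : x ∈ M by
    obtain ⟨a, ha, hax⟩ := Submodule.mem_map.1 hxM
    exact ⟨a, ha, hax.symm⟩
  have hZt : 𝒵 ∩ φ.left.base ⁻¹' {t.pt} =
      ⋃₀ (↑((Finset.univ : Finset S).biUnion F) : Set (Set X.left)) := by
    ext z
    rw [Set.mem_sUnion]
    constructor
    · rintro ⟨hz, hzt⟩
      rw [hZS] at hz
      obtain ⟨V, hVS, hzV⟩ := Set.mem_sUnion.1 hz
      have hz' : z ∈ V ∩ φ.left.base ⁻¹' {t.pt} := ⟨hzV, hzt⟩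
      rw [hF ⟨V, hVS⟩, Set.mem_sUnion] at hz'
      obtain ⟨D, hD, hzD⟩ := hz'
      exact ⟨D, Finset.mem_coe.2 (Finset.mem_biUnion.2
        ⟨⟨V, hVS⟩, Finset.mem_univ _, Finset.mem_coe.1 hD⟩), hzD⟩
    · rintro ⟨D, hD, hzD⟩
      obtain ⟨V, -, hDV⟩ := Finset.mem_biUnion.1 (Finset.mem_coe.1 hD)
      have hz' : z ∈ (V : Set X.left) ∩ φ.left.base ⁻¹' {t.pt} := by
        rw [hF V, Set.mem_sUnion]
        exact ⟨D, Finset.mem_coe.2 hDV, hzD⟩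
      exact ⟨hZS ▸ Set.mem_sUnion_of_mem hz'.1 V.2, hz'.2⟩
  have hx' : x ∈ LinearMap.ker (complexBetti.restrictCompl X
      (⋃₀ (↑((Finset.univ : Finset S).biUnion F) : Set (Set X.left))) (2 * (p + 1))).hom := by
    rw [← hZt]
    exact LinearMap.mem_ker.2 hx
  refine ker_restrictCompl_sUnion_le_of_forall_le hX (l := p + 1) _ (fun D hD ↦ ?_) (fun D hD ↦ ?_)
    (fun D hD ↦ ?_) (fun D hD ↦ ?_) hx'
  · obtain ⟨V, -, hDV⟩ := Finset.mem_biUnion.1 hD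
    exact (hFD V D hDV).1
  · obtain ⟨V, -, hDV⟩ := Finset.mem_biUnion.1 hD
    exact (hFD V D hDV).2.1
  · obtain ⟨V, -, hDV⟩ := Finset.mem_biUnion.1 hD
    exact (hFD V D hDV).2.2.1
  · obtain ⟨V, -, hDV⟩ := Finset.mem_biUnion.1 hD
    refine (hFD V D hDV).2.2.2.trans ?_
    rw [Submodule.span_singleton_le_iff_mem, hMdef]
    exact Submodule.mem_map_of_mem (Submodule.subset_span ⟨V, rfl⟩)

end Main


end HodgeTheory

end Literature.AlgebraicGeometry.HodgeTheory

end
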